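import Literature.MathematicalPhysics.QuantumLattice.SectorEigenvalueContinuation
import HarnessLib

/-!
# Free canonical gas at `β·t = 8` — Combes–Thomas toolkit for stub S4 (conjugation identity, entry extraction, Schur test)

Helper file for route `TcThermcert1` (crux K1′ `ThermalStiffnessCeilingU8b8_le_7o44`, item `stmt-Ventures-24560`), crux idea
`free-canonical-b8-rung`, stub S4 (`stub_arcPropagator_decay`: uniform-in-`L` exponential decay of the complex-fugacity Fermi kernel
`G_ζ = ζK(1+ζK)⁻¹` on the good arc). Recommended route (memo `Cruxes/…/FreeCanonicalB8-leafhand-g0.md` §2): Combes–Thomas BY CONJUGATION,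
entirely finite-dimensional — conjugate by `ρ_w = diag(e^{w})` for a weight `w` that is 1-Lipschitz in the torus distance, control
`‖ρ_w G_ζ ρ_w⁻¹‖` through the resolvent gap (`Theorems/TcThermcert1FreeCanonicalGoodArcGap.lean`) and a Neumann series, and read the
decay off the entries. This file supplies the three norm-free algebraic tools of that route:

* §1 `(ρ_w M ρ_w⁻¹)_{xy} = e^{w(x) − w(y)} M_{xy}`, hence `|M_{xy}| ≤ C e^{w(y) − w(x)}` from any entry bound `C` on the conjugate;
* §2 entries are controlled by the Euclidean gain (tree: `EigenvalueContinuation.re_star_dotProduct_self`, `norm_apply_sq_le`);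
* §3 the **Schur test** `Re⟨Av, Av⟩ ≤ R·C·Re⟨v, v⟩` for a matrix with absolute row sums `≤ R` and column sums `≤ C` (square-root-free
  Cauchy–Schwarz) — converts the nearest-neighbour bound `‖h_w − h‖_{rows} ≤ 4(e^{|w|} − 1)` into a Euclidean operator bound.

NOT here: the exponential perturbation bound `‖e^{−βh_w} − e^{−βh}‖` (Duhamel) and the assembly of S4.

HONEST LABEL: finite-dimensional linear algebra; a step of a RUNG (`U = 0`, BC5-type witness for the C8 bet), reach at `U = 8` ZERO; decides
nothing about K1/K1′/`T_c`; superconductivity in the Hubbard model is NOT proved or advanced by this file beyond the rung.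
-/

noncomputable section

namespace Summit.Ventures.CertifiedManyBodySolver.Theorems.TcThermcert1.FreeCanonicalB8

open Matrix Finset
open Literature.MathematicalPhysics.QuantumLattice
open scoped ComplexOrder ComplexConjugate

variable {ι : Type*} [Fintype ι]

/-! ## §1 Conjugation by exponential weights -/

section Conj

variable [DecidableEq ι]

/-- `(diag(e^{w}) · M · diag(e^{−w}))_{xy} = e^{w(x) − w(y)} · M_{xy}`. -/
theorem diagonal_exp_mul_mul_diagonal_exp_neg_apply (w : ι → ℝ) (M : Matrix ι ι ℂ) (x y : ι) :
    (diagonal (fun i => ((Real.exp (w i) : ℝ) : ℂ)) * M * diagonal (fun i => ((Real.exp (-w i) : ℝ) : ℂ))) x y =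
      ((Real.exp (w x - w y) : ℝ) : ℂ) * M x y := by
  rw [mul_diagonal, diagonal_mul, Real.exp_sub, Real.exp_neg, div_eq_mul_inv]
  push_cast
  ring

/-- **Entry decay from a bound on the conjugate**: if `|(ρ_w M ρ_w⁻¹)_{xy}| ≤ C` then `|M_{xy}| ≤ C · e^{w(y) − w(x)}`. -/
theorem norm_apply_le_of_conj_bound (w : ι → ℝ) (M : Matrix ι ι ℂ) {C : ℝ} (x y : ι)
    (hC : ‖(diagonal (fun i => ((Real.exp (w i) : ℝ) : ℂ)) * M * diagonal (fun i => ((Real.exp (-w i) : ℝ) : ℂ))) x y‖ ≤ C) :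
    ‖M x y‖ ≤ C * Real.exp (w y - w x) := by
  rw [diagonal_exp_mul_mul_diagonal_exp_neg_apply, norm_mul, Complex.norm_real, Real.norm_of_nonneg (Real.exp_pos _).le] at hC
  have hpos : 0 < Real.exp (w x - w y) := Real.exp_pos _
  rw [show w y - w x = -(w x - w y) by ring, Real.exp_neg, ← div_eq_mul_inv, le_div_iff₀ hpos, mul_comm]
  exact hC

end Conj

/-! ## §2 Entries versus the Euclidean gain

`Re⟨u, u⟩ = Σ_x |u_x|²` and `|u_x|² ≤ Re⟨u, u⟩` are the tree's `EigenvalueContinuation.re_star_dotProduct_self` /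
`EigenvalueContinuation.norm_apply_sq_le` (`Literature/MathematicalPhysics/QuantumLattice/SectorEigenvalueContinuation.lean`), reused below. -/

/-! ## §3 The Schur test -/

/-- **Schur test.** If every row of `A` has absolute sum `≤ R` and every column absolute sum `≤ C`, then
`Re⟨Av, Av⟩ ≤ R · C · Re⟨v, v⟩` for every vector `v`. -/
theorem schur_test (A : Matrix ι ι ℂ) {R C : ℝ} (hR : ∀ x, ∑ y, ‖A x y‖ ≤ R) (hC : ∀ y, ∑ x, ‖A x y‖ ≤ C) (v : ι → ℂ) :
    (star (A *ᵥ v) ⬝ᵥ (A *ᵥ v)).re ≤ R * C * (star v ⬝ᵥ v).re := by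
  rw [EigenvalueContinuation.re_star_dotProduct_self, EigenvalueContinuation.re_star_dotProduct_self]
  rcases isEmpty_or_nonempty ι with hι | hι
  · simp
  obtain ⟨x₀⟩ := hι
  have hR0 : 0 ≤ R := le_trans (Finset.sum_nonneg fun y _ => norm_nonneg _) (hR x₀)
  -- pointwise: `|(Av)_x|² ≤ (Σ_y |A_{xy}|) · Σ_y |A_{xy}| |v_y|²`
  have hpt : ∀ x, ‖(A *ᵥ v) x‖ ^ 2 ≤ R * ∑ y, ‖A x y‖ * ‖v y‖ ^ 2 := by
    intro x
    have h1 : ‖(A *ᵥ v) x‖ ≤ ∑ y, ‖A x y‖ * ‖v y‖ := by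
      rw [Matrix.mulVec, dotProduct]
      exact (norm_sum_le _ _).trans (Finset.sum_le_sum fun y _ => (norm_mul_le _ _))
    have h2 : (∑ y, ‖A x y‖ * ‖v y‖) ^ 2 ≤ (∑ y, ‖A x y‖) * ∑ y, ‖A x y‖ * ‖v y‖ ^ 2 :=
      Finset.sum_sq_le_sum_mul_sum_of_sq_le_mul Finset.univ (fun y _ => norm_nonneg _)
        (fun y _ => mul_nonneg (norm_nonneg _) (sq_nonneg _)) (fun y _ => le_of_eq (by ring))
    have h3 : 0 ≤ ∑ y, ‖A x y‖ * ‖v y‖ ^ 2 := Finset.sum_nonneg fun y _ => mul_nonneg (norm_nonneg _) (sq_nonneg _)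
    calc ‖(A *ᵥ v) x‖ ^ 2 ≤ (∑ y, ‖A x y‖ * ‖v y‖) ^ 2 := pow_le_pow_left₀ (norm_nonneg _) h1 2
      _ ≤ (∑ y, ‖A x y‖) * ∑ y, ‖A x y‖ * ‖v y‖ ^ 2 := h2
      _ ≤ R * ∑ y, ‖A x y‖ * ‖v y‖ ^ 2 := mul_le_mul_of_nonneg_right (hR x) h3
  calc ∑ x, ‖(A *ᵥ v) x‖ ^ 2 ≤ ∑ x, R * ∑ y, ‖A x y‖ * ‖v y‖ ^ 2 := Finset.sum_le_sum fun x _ => hpt x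
    _ = R * ∑ y, (∑ x, ‖A x y‖) * ‖v y‖ ^ 2 := by
        rw [← Finset.mul_sum, Finset.sum_comm]
        congr 1
        exact Finset.sum_congr rfl fun y _ => by rw [Finset.sum_mul]
    _ ≤ R * ∑ y, C * ‖v y‖ ^ 2 :=
        mul_le_mul_of_nonneg_left (Finset.sum_le_sum fun y _ => mul_le_mul_of_nonneg_right (hC y) (sq_nonneg _)) hR0
    _ = R * C * ∑ y, ‖v y‖ ^ 2 := by rw [← Finset.mul_sum]; ring

end Summit.Ventures.CertifiedManyBodySolver.Theorems.TcThermcert1.FreeCanonicalB8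

end
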